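import Summits.MatrixMultiplication.MatrixMultiplication.Theses.IrreducibleSublevelSets

/-!
# Crux `FewAsymptoticRanks` (stmt-MatrixMultiplication-19019) — birth skeleton, line `birth` (BC3)

Route `route-MatrixMultiplication-IrreducibleSublevelSets`, crux (rank 9, auto-crux of a support item):

  `FewAsymptoticRanks : ∀ a b c : ℕ,
      (Set.range fun T : Fin a → Fin b → Fin c → ℂ => asymptoticRank T).encard ≤ (a * b * c + 1 : ℕ)`

— Christandl–Hoeberechts–Nieuwboer–Vrana–Zuiddam's printed weak form of Strassen's asymptotic rank
conjecture (arXiv:2411.15789, §5 p. 14): a format `a × b × c` over `ℂ` realises at most `abc + 1`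
distinct asymptotic ranks.

THE LINE (the printed "dimension argument", CHNVZ §5 p. 14, cut into its three genuine lemmas; this is
the derivation the route was opened on — `FewAsymptoticRanks` is BY DESIGN the corollary node of the
sibling crux `SublevelIrreducible`, stmt-MatrixMultiplication-19017, through the support item
`IrreducibleFewBridge`, stmt-MatrixMultiplication-19020):

* `stub_sublevelPrime` — THE OPEN INPUT, the sibling crux `SublevelIrreducible` BY NAME (so the cone
  of `closes` sees the dependency): every sublevel set `Z_r = {T ∈ ℂ^{a×b×c} : R̃(T) ≤ r}`, `r ≥ 0`, has a
  prime vanishing ideal in `ℂ[x_{ijk}]`. Open (CHNVZ: "For k ≥ 3, irreduciblity is open"); size: open-problem.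
* `stub_vanishingIdeal_lt` — STRICTNESS OF THE IDEAL CHAIN between realised levels: if
  `R̃(S) < R̃(T)` in one format then `I(Z_{R̃(T)}) < I(Z_{R̃(S)})` strictly. Why true: `Z_{R̃(S)} ⊆ Z_{R̃(T)}`
  gives `≤` (`MvPolynomial.vanishingIdeal_anti_mono`); the entries of `T` lie in `Z_{R̃(T)}` but not in
  `Z_{R̃(S)}`, and `Z_{R̃(S)}` is ZARISKI CLOSED — CHNVZ Thm 1.2, PROVED in tree as
  `Literature.Computability.AlgebraicComplexity.chnvz_zariskiClosed_asymptoticRank_le_holds` — so some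
  polynomial vanishes on `Z_{R̃(S)}` and not at `T`. Size: M (unpacking the printed Zariski-closure form of
  the tree fact, `tensorEntries`/currying bookkeeping, `aeval = eval` over `ℂ`).
* `stub_primeChain_length_le` — DIMENSION THEORY: a strictly decreasing chain `P₀ > P₁ > ⋯ > P_n` of prime
  ideals of `ℂ[x_{ijk} : (i,j,k) ∈ a × b × c]` has `n ≤ abc`. Why true: `ringKrullDim (MvPolynomial σ ℂ)
  = Nat.card σ` (Mathlib `MvPolynomial.ringKrullDim_of_isNoetherianRing` + `ringKrullDim_eq_zero_of_field`),
  and a chain of `n + 1` primes is an `LTSeries (PrimeSpectrum _)` of length `n ≤ krullDim`. Size: M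
  (Mathlib plumbing: `Order.krullDim`, `LTSeries`, `WithBot ℕ∞` casts).
* `FewAsymptoticRanks_of : <stub₁> → <stub₂> → <stub₃> → FewAsymptoticRanks` — the COMPOSITION, a REAL
  proof (no `sorry`): if a format had more than `abc + 1` values, pick `abc + 2` of them
  (`Set.exists_subset_encard_eq`), sort them increasingly (`Finset.orderEmbOfFin`), choose realising
  tensors; stub 1 makes the ideals `I(Z_{v_m})` prime (`v_m = R̃(T_m) ≥ 0`), stub 2 makes `m ↦ I(Z_{v_m})`
  strictly antitone, and stub 3 bounds the resulting chain of `abc + 2` primes: `abc + 1 ≤ abc`, absurd.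
* `FewAsymptoticRanks_skeleton : FewAsymptoticRanks` — the same composition fed with the three sorried
  stubs (concludes the crux BY NAME with no hypotheses; its only `sorry`s are inside `stub_*`).

Disproof used: no `Disproof.lean` exists for this crux (`ledger crux ls stmt-MatrixMultiplication-19019`:
no workfiles before this one). The refuter lane `Theorems/FewAsymptoticRanks/Negative/TightSmallFormats.lean`
(p142831) proves `fewAsymptoticRanks_false_without_addOne` — ANY PROOF MUST USE THE `+ 1` — and tightness at
`abc = 0` and `1 × 1 × 1`. This line honours it at `stub_primeChain_length_le`: `abc + 2` values give only
`abc + 1` STRICT inclusions, and it is the number of strict steps (not of values) that the Krull dimension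
`abc` bounds — the `+ 1` is exactly the chain/element off-by-one. No stub is an instance of a landed
Negative lemma (those concern the value sets of formats `0 × b × c` and `1 × 1 × 1`, consistent with all
three stubs). Negatives index of the summit: design statements only, none on `R̃` value sets.

Imports are STATEMENT-LEVEL only (the route file, which brings Mathlib and the `asymptoticRank`
currency): the proof file `AsymptoticRankZariskiClosedProofs` is NOT imported, so the BC3 probes test
the stubs, not the library.
-/

-- the tree's namespace `Summit.MatrixMultiplication.MatrixMultiplication.…` repeats a component by design
set_option linter.dupNamespace false

noncomputable section

namespace Summit.MatrixMultiplication.MatrixMultiplication.Cruxes.FewAsymptoticRanks.Birth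

open Literature.Computability.AlgebraicComplexity
open Summit.MatrixMultiplication.MatrixMultiplication.Theses.IrreducibleSublevelSets
  (SublevelIrreducible FewAsymptoticRanks)

/-- **Stub 1 — irreducibility of the sublevel sets (the open input; the sibling crux
`SublevelIrreducible`, stmt-MatrixMultiplication-19017, BY NAME).** For every format `a × b × c` over `ℂ`
and every level `r ≥ 0`, the vanishing ideal in `ℂ[x_{ijk}]` of the sublevel set
`Z_r = {x : R̃(x) ≤ r}` is prime (CHNVZ §5 p. 14: "we may ask if they are irreducible … For k ≥ 3,
irreduciblity is open"). Why plausibly true: it holds for `k = 2` (determinantal varieties) and in every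
computed case (`2 × 2 × 2`: `Z_0 = {0}`, `Z_1 =` Segre cone, `Z_2 = ℂ⁸`); under the asymptotic rank
conjecture every `Z_r` is a subspace variety `Sub_{n,n,n}`, which is irreducible. Size: open-problem
(it is the route's rank-2 crux; its own birth skeleton is DominantParametrisation → PrimeOfImage).
Leans on: `MvPolynomial.vanishingIdeal`, `Ideal.IsPrime` (Mathlib), `asymptoticRank` (tree).
[cite: ChristandlHoeberechtsNieuwboerVranaZuiddam2025, §5 p. 14] -/
theorem stub_sublevelPrime : SublevelIrreducible := by
  sorry

/-- **Stub 2 — the chain of vanishing ideals is STRICT between realised levels (CHNVZ Thm 1.2).**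
If `R̃(S) < R̃(T)` for two tensors of the same format, then the vanishing ideal of the larger sublevel
set `Z_{R̃(T)}` is STRICTLY smaller than that of `Z_{R̃(S)}`. Why true: `≤` is antitonicity of
`vanishingIdeal`; for `≠`, the entry vector of `T` lies in `Z_{R̃(T)} ∖ Z_{R̃(S)}`, and `Z_{R̃(S)}` is
Zariski closed by Christandl–Hoeberechts–Nieuwboer–Vrana–Zuiddam Thm 1.2 — PROVED in tree as
`chnvz_zariskiClosed_asymptoticRank_le_holds` (file `AsymptoticRankZariskiClosedProofs`, deliberately not
imported here) — so some polynomial vanishing on `Z_{R̃(S)}` does not vanish at `T`; it lies in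
`I(Z_{R̃(S)}) ∖ I(Z_{R̃(T)})`. Size: M (the tree fact is stated with `MvPolynomial.eval ∘ tensorEntries`
over curried tensors, the ideal with `aeval` over points `x : a × b × c → ℂ`; `Prod` eta does the
currying). Leans on: `chnvz_zariskiClosed_asymptoticRank_le_holds`, `tensorEntries` (tree);
`MvPolynomial.vanishingIdeal_anti_mono`, `MvPolynomial.mem_vanishingIdeal_iff`, `MvPolynomial.coe_aeval_eq_eval`
(Mathlib). [cite: ChristandlHoeberechtsNieuwboerVranaZuiddam2025, Theorem 1.2] -/
theorem stub_vanishingIdeal_lt :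
    ∀ (a b c : ℕ) (S T : Fin a → Fin b → Fin c → ℂ), asymptoticRank S < asymptoticRank T →
      MvPolynomial.vanishingIdeal ℂ
          {x : Fin a × Fin b × Fin c → ℂ |
            asymptoticRank (fun (i : Fin a) (j : Fin b) (k : Fin c) => x (i, j, k)) ≤ asymptoticRank T}
        < MvPolynomial.vanishingIdeal ℂ
          {x : Fin a × Fin b × Fin c → ℂ |
            asymptoticRank (fun (i : Fin a) (j : Fin b) (k : Fin c) => x (i, j, k)) ≤ asymptoticRank S} := by
  sorry

/-- **Stub 3 — prime chains in `ℂ[x_{ijk}]` have length at most `abc` (Krull dimension of affine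
`abc`-space).** Every strictly decreasing family `P₀ > P₁ > ⋯ > P_n` of prime ideals of
`MvPolynomial (Fin a × Fin b × Fin c) ℂ` has `n ≤ a·b·c`. Why true: `ringKrullDim (MvPolynomial σ ℂ) =
ringKrullDim ℂ + Nat.card σ = abc` (Mathlib `MvPolynomial.ringKrullDim_of_isNoetherianRing`,
`ringKrullDim_eq_zero_of_field`), and the reversed family is an `LTSeries (PrimeSpectrum _)` of length
`n`, bounded by `Order.krullDim` (`LTSeries.length_le_krullDim`). This is the printed "topological
dimension is maximal length of a decreasing chain of irreducible subvarieties, and the dimension of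
`𝔽^{d₁×⋯×d_k}` is `d₁⋯d_k`". Size: M (Mathlib plumbing through `WithBot ℕ∞`). Leans on: `ringKrullDim`,
`Order.krullDim`, `LTSeries`, `PrimeSpectrum` (Mathlib).
[cite: ChristandlHoeberechtsNieuwboerVranaZuiddam2025, §5 p. 14 (dimension argument)] -/
theorem stub_primeChain_length_le :
    ∀ (a b c n : ℕ) (P : Fin (n + 1) → Ideal (MvPolynomial (Fin a × Fin b × Fin c) ℂ)),
      (∀ m, (P m).IsPrime) → StrictAnti P → n ≤ a * b * c := by
  sorry

/-- **Composition (kernel-checked, no `sorry`): stub 1 → stub 2 → stub 3 → `FewAsymptoticRanks`.**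
Fix a format. If the value set `V = {R̃(T)}` had `encard V > abc + 1`, extract `U ⊆ V` with exactly
`abc + 2` elements (`Set.exists_subset_encard_eq`), enumerate it increasingly as
`v : Fin (abc + 2) ↪o ℝ` (`Finset.orderEmbOfFin`) and choose tensors `T_m` with `R̃(T_m) = v_m`. The
ideals `P_m = I(Z_{v_m})` are prime by stub 1 (`v_m = R̃(T_m) ≥ 0`, `asymptoticRank_nonneg`), strictly
antitone in `m` by stub 2, so stub 3 gives `abc + 1 ≤ abc` — absurd. The `+ 1` of the crux is consumed
exactly here: `abc + 2` VALUES are needed to get `abc + 1` STRICT inclusions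
(cf. `fewAsymptoticRanks_false_without_addOne` in `Theorems/FewAsymptoticRanks/Negative/TightSmallFormats.lean`).
[cite: ChristandlHoeberechtsNieuwboerVranaZuiddam2025, §5 p. 14] -/
theorem FewAsymptoticRanks_of :
    SublevelIrreducible →
    (∀ (a b c : ℕ) (S T : Fin a → Fin b → Fin c → ℂ), asymptoticRank S < asymptoticRank T →
      MvPolynomial.vanishingIdeal ℂ
          {x : Fin a × Fin b × Fin c → ℂ |
            asymptoticRank (fun (i : Fin a) (j : Fin b) (k : Fin c) => x (i, j, k)) ≤ asymptoticRank T}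
        < MvPolynomial.vanishingIdeal ℂ
          {x : Fin a × Fin b × Fin c → ℂ |
            asymptoticRank (fun (i : Fin a) (j : Fin b) (k : Fin c) => x (i, j, k)) ≤ asymptoticRank S}) →
    (∀ (a b c n : ℕ) (P : Fin (n + 1) → Ideal (MvPolynomial (Fin a × Fin b × Fin c) ℂ)),
      (∀ m, (P m).IsPrime) → StrictAnti P → n ≤ a * b * c) →
    FewAsymptoticRanks := by
  intro hprime hstrict hchain a b c
  by_contra hlt
  rw [not_le] at hlt
  -- `abc + 2` distinct values
  obtain ⟨U, hUV, hUcard⟩ :=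
    Set.exists_subset_encard_eq ((ENat.add_one_le_iff (ENat.coe_ne_top (a * b * c + 1))).2 hlt)
  have hUcard' : U.encard = ((a * b * c + 1 + 1 : ℕ) : ℕ∞) := by
    rw [hUcard]; norm_cast
  have hUfin : U.Finite := Set.finite_of_encard_eq_coe hUcard'
  have hcardF : hUfin.toFinset.card = a * b * c + 1 + 1 := by
    have h := hUfin.encard_eq_coe_toFinset_card
    rw [hUcard'] at h
    exact_mod_cast h.symm
  -- sorted increasingly
  set v : Fin (a * b * c + 1 + 1) ↪o ℝ := hUfin.toFinset.orderEmbOfFin hcardF with hv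
  have hvU : ∀ m, v m ∈ U := fun m => by
    have h := hUfin.toFinset.orderEmbOfFin_mem hcardF m
    rwa [Set.Finite.mem_toFinset] at h
  -- realising tensors
  choose T hT using fun m => Set.mem_range.mp (hUV (hvU m))
  -- the chain of prime vanishing ideals
  have hP : ∀ m : Fin (a * b * c + 1 + 1),
      (MvPolynomial.vanishingIdeal ℂ
        {x : Fin a × Fin b × Fin c → ℂ |
          asymptoticRank (fun (i : Fin a) (j : Fin b) (k : Fin c) => x (i, j, k)) ≤ v m}).IsPrime :=
    fun m => hprime a b c (v m) ((asymptoticRank_nonneg (T m)).trans_eq (hT m))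
  have hanti : StrictAnti fun m : Fin (a * b * c + 1 + 1) =>
      MvPolynomial.vanishingIdeal ℂ
        {x : Fin a × Fin b × Fin c → ℂ |
          asymptoticRank (fun (i : Fin a) (j : Fin b) (k : Fin c) => x (i, j, k)) ≤ v m} := by
    intro m m' hmm'
    have hvmm' : asymptoticRank (T m) < asymptoticRank (T m') := by
      rw [hT m, hT m']
      exact v.strictMono hmm'
    have h := hstrict a b c (T m) (T m') hvmm'
    rw [hT m, hT m'] at h
    exact h
  have key := hchain a b c (a * b * c + 1) _ hP hanti
  exact Nat.not_succ_le_self _ key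

/-- **The skeleton theorem: `FewAsymptoticRanks` from the three declared stubs** (concludes the route
crux `Summit.MatrixMultiplication.MatrixMultiplication.Theses.IrreducibleSublevelSets.FewAsymptoticRanks`
BY NAME with no hypotheses; its only `sorry`s are inside `stub_sublevelPrime`, `stub_vanishingIdeal_lt`,
`stub_primeChain_length_le`). [cite: ChristandlHoeberechtsNieuwboerVranaZuiddam2025, §5 p. 14] -/
theorem FewAsymptoticRanks_skeleton : FewAsymptoticRanks :=
  FewAsymptoticRanks_of stub_sublevelPrime stub_vanishingIdeal_lt stub_primeChain_length_le

end Summit.MatrixMultiplication.MatrixMultiplication.Cruxes.FewAsymptoticRanks.Birth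

end
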